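import Mathlib
import HarnessLib
import Literature.Computability.AlgebraicComplexity.PatternExpressions
import Literature.Computability.AlgebraicComplexity.HamiltonianCycleVNP

/-!
# Homomorphism polynomials of polynomial-size patterns are p-definable (`VNP`)

Route MonotoneRestoration, aside R1 = `OrbitRestorationLinearVolumeQP` (stmt-ValiantsHypothesis-18294).  The
VH-strength placement `…LinearVolumeQPVHStrength.lean` of R1 takes as a hypothesis that the homomorphism
polynomials `hom_{F_n,n}` (tree `homPoly`, Dwivedi–Pago–Seppelt 2026 eq. (1)) of a pattern family form a `VNP`
family.  This file PROVES that input for every bipartite multigraph pattern family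
`F_n = (Fin (a n) ⊔ Fin (b n), E n)` of polynomial size (`a n, b n, |E n| ≤ (n+2)^c`), in the format of the
tree's `HC ∈ VNP` (`Literature/…/HamiltonianCycleVNP.lean`, Bürgisser 2000 Def. 2.5 literally):

  `hom_{F,n}(X) = Σ_{(β, β') ∈ {0,1}^{a·n} × {0,1}^{b·n}} R_a(β) · R_b(β') · Π_{(u,v) ∈ E} Σ_{i,j} β_{u,i} β'_{v,j} X_{ij}`,

where `R_a(β) = Π_{(p,q) same row, p ≠ q} (1 - β_p β_q) · Π_u Σ_i β_{u,i}` recognises the graphs of functions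
`Fin a → Fin n` among the Boolean `a × n` matrices (the one-sided version of BCS's permutation-matrix
recogniser `α · β`, `HamiltonianCycleVNP.sum_recogniser_mul`).

* `sum_fnRecogniser_mul` — Boolean sums against `R_a` are sums over functions `Fin a → Fin n`;
* `homWitness`, `boolSum_homWitness` — the witness and `boolSum (homWitness a b n E) = homPoly E n k`;
* degree / complexity bounds, `isVPFamily_homVNPFamily`;
* `isVNPFamily_homPoly` — **`(hom_{F_n,n})_n ∈ VNP`** for pattern families of polynomial size (any commutative
  ring `k`).

Honest framing: a standard Valiant-criterion instance (Dwivedi–Pago–Seppelt 2026 use `hom_F ∈ VNP` throughout,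
e.g. Lemma `colourful-containment`); it discharges hypothesis `hVNP` of
`OrbitRestorationLinearVolumeQPVHStrength.valiantsHypothesis_of_orbitRestorationLinearVolumeQP_of_separatingPattern`,
leaving the CFI separation as the only printed input of "R1 ⇒ VP ≠ VNP".  Nothing here bears on R1 itself.
-/

noncomputable section

open MvPolynomial Equiv

-- `Summit.ValiantsHypothesis.ValiantsHypothesis.…` is the tree's single-conjunct layout (Sub = Summit).
set_option linter.dupNamespace false

namespace Summit.ValiantsHypothesis.ValiantsHypothesis.Theorems

namespace HomPolyVNP

open Literature.Computability.AlgebraicComplexity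

universe u

/-! ### The function-graph recogniser on Boolean `N × n` matrices -/

section Recogniser

variable {N n : ℕ}

/-- Conflicting ordered pairs of positions of an `N × n` Boolean matrix for FUNCTION graphs: two distinct
positions in the same row. [cite: BurgisserClausenShokrollahi1997, Prop. (21.15)] -/
def fnConflicts (N n : ℕ) : Finset ((Fin N × Fin n) × (Fin N × Fin n)) :=
  Finset.univ.filter fun pq => pq.1 ≠ pq.2 ∧ pq.1.1 = pq.2.1

/-- There are at most `(N n)²` conflicting pairs. [folklore] -/
theorem card_fnConflicts_le (N n : ℕ) : (fnConflicts N n).card ≤ (N * n) * (N * n) := by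
  refine (Finset.card_filter_le _ _).trans ?_
  simp only [Finset.card_univ, Fintype.card_prod, Fintype.card_fin]
  exact le_rfl

/-- The graph of `h : Fin N → Fin n` as a Boolean matrix, entry `(t, i) = [h t = i]`. [folklore] -/
def fnGraph (h : Fin N → Fin n) : Fin N × Fin n → Bool := fun p => decide (h p.1 = p.2)

/-- A function is determined by its graph. [folklore] -/
theorem fnGraph_injective : Function.Injective (fnGraph (N := N) (n := n)) := by
  intro h h' hh
  funext t
  have h1 := congrFun hh (t, h t)
  simp only [fnGraph, decide_true, true_eq_decide_iff] at h1
  exact h1.symm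

/-- At the graph of a function the recogniser takes the value `1`.
[cite: BurgisserClausenShokrollahi1997, Prop. (21.15)] -/
theorem fnRecogniser_fnGraph {R : Type*} [CommRing R] (h : Fin N → Fin n) :
    (∏ pq ∈ fnConflicts N n, (1 - (if fnGraph h pq.1 then (1 : R) else 0) *
        (if fnGraph h pq.2 then (1 : R) else 0))) *
      (∏ t, ∑ i, (if fnGraph h (t, i) then (1 : R) else 0)) = 1 := by
  have hα : ∀ pq ∈ fnConflicts N n, (1 - (if fnGraph h pq.1 then (1 : R) else 0) *
      (if fnGraph h pq.2 then (1 : R) else 0)) = 1 := by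
    rintro ⟨p, q⟩ hpq
    simp only [fnConflicts, Finset.mem_filter, Finset.mem_univ, true_and] at hpq
    obtain ⟨hne, hrow⟩ := hpq
    have hnot : ¬ (fnGraph h p = true ∧ fnGraph h q = true) := by
      simp only [fnGraph, decide_eq_true_eq]
      rintro ⟨hp, hq⟩
      exact hne (Prod.ext hrow (by rw [← hp, ← hq, hrow]))
    by_cases hp : fnGraph h p = true
    · by_cases hq : fnGraph h q = true
      · exact absurd ⟨hp, hq⟩ hnot
      · simp [hq]
    · simp [hp]
  have hβ : ∀ t, (∑ i, (if fnGraph h (t, i) then (1 : R) else 0)) = 1 := by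
    intro t
    simp [fnGraph, Finset.sum_ite_eq]
  rw [Finset.prod_eq_one hα, Finset.prod_eq_one (fun t _ => hβ t), one_mul]

/-- Away from function graphs the recogniser vanishes. [cite: BurgisserClausenShokrollahi1997, Prop. (21.15)] -/
theorem fnRecogniser_eq_zero {R : Type*} [CommRing R] {E : Fin N × Fin n → Bool}
    (hE : ∀ h : Fin N → Fin n, fnGraph h ≠ E) :
    (∏ pq ∈ fnConflicts N n, (1 - (if E pq.1 then (1 : R) else 0) *
        (if E pq.2 then (1 : R) else 0))) *
      (∏ t, ∑ i, (if E (t, i) then (1 : R) else 0)) = 0 := by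
  classical
  by_cases h1 : ∃ pq ∈ fnConflicts N n, E pq.1 = true ∧ E pq.2 = true
  · obtain ⟨pq, hpq, hp, hq⟩ := h1
    rw [Finset.prod_eq_zero hpq (by simp [hp, hq]), zero_mul]
  push Not at h1
  by_cases h2 : ∃ t, ∀ i, E (t, i) = false
  · obtain ⟨t, ht⟩ := h2
    rw [Finset.prod_eq_zero (Finset.mem_univ t) (by simp [ht]), mul_zero]
  push Not at h2
  exfalso
  choose v hv using h2
  have hv' : ∀ t, E (t, v t) = true := fun t => by simpa using hv t
  have hrow : ∀ t i, E (t, i) = true → i = v t := by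
    intro t i hi
    by_contra hne
    have hmem : ((t, i), (t, v t)) ∈ fnConflicts N n :=
      Finset.mem_filter.2 ⟨Finset.mem_univ _, fun h => hne (Prod.ext_iff.1 h).2, rfl⟩
    exact h1 _ hmem hi (hv' t)
  apply hE v
  funext ⟨t, i⟩
  simp only [fnGraph]
  by_cases hi : E (t, i) = true
  · rw [hi, decide_eq_true_iff]
    exact (hrow t i hi).symm
  · rw [Bool.not_eq_true] at hi
    rw [hi, decide_eq_false_iff_not]
    intro h
    rw [← h, hv'] at hi
    exact Bool.noConfusion hi

/-- **Boolean sums against the function recogniser are sums over functions**: for any weight `G`,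
`Σ_{E ∈ {0,1}^{N×n}} R(E) G(E) = Σ_{h : Fin N → Fin n} G(graph h)`.
[cite: BurgisserClausenShokrollahi1997, Prop. (21.15)] -/
theorem sum_fnRecogniser_mul {R : Type*} [CommRing R] (G : (Fin N × Fin n → Bool) → R) :
    ∑ E : Fin N × Fin n → Bool,
      (∏ pq ∈ fnConflicts N n, (1 - (if E pq.1 then (1 : R) else 0) *
          (if E pq.2 then (1 : R) else 0))) *
        (∏ t, ∑ i, (if E (t, i) then (1 : R) else 0)) * G E =
      ∑ h : Fin N → Fin n, G (fnGraph h) := by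
  classical
  have h : ∀ E : Fin N × Fin n → Bool,
      (∏ pq ∈ fnConflicts N n, (1 - (if E pq.1 then (1 : R) else 0) *
          (if E pq.2 then (1 : R) else 0))) *
        (∏ t, ∑ i, (if E (t, i) then (1 : R) else 0)) * G E =
      if ∃ h : Fin N → Fin n, fnGraph h = E then G E else 0 := by
    intro E
    split_ifs with hσ
    · obtain ⟨h, rfl⟩ := hσ
      rw [fnRecogniser_fnGraph, one_mul]
    · push Not at hσ
      rw [fnRecogniser_eq_zero hσ, zero_mul]
  rw [Finset.sum_congr rfl fun E _ => h E, ← Finset.sum_filter]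
  have hfi : (Finset.univ.filter fun E : Fin N × Fin n → Bool =>
      ∃ h : Fin N → Fin n, fnGraph h = E) = Finset.univ.image fnGraph := by
    ext E
    simp
  rw [hfi, Finset.sum_image fun σ _ σ' _ h => fnGraph_injective h]

end Recogniser

/-! ### The witness -/

section Witness

variable (a b n : ℕ) (k : Type u) [CommRing k]

/-- The variables of the witness: the `n × n` matrix variables (`Sum.inl`) and `a·n + b·n` Boolean variables
`β_{u,i}` (`u < a`, block `Sum.inl` of `finSumFinEquiv`) and `β'_{v,j}` (`v < b`, block `Sum.inr`), enumerated by
`Fin (a n + b n)` as `IsVNPFamily` requires. [folklore] -/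
abbrev HVars : Type := (Fin n × Fin n) ⊕ Fin (a * n + b * n)

/-- The Boolean variable `β_{u,i}` of the row block. [folklore] -/
def yv (p : Fin a × Fin n) : HVars a b n :=
  Sum.inr (finSumFinEquiv (Sum.inl (finProdFinEquiv p)))

/-- The Boolean variable `β'_{v,j}` of the column block. [folklore] -/
def zv (q : Fin b × Fin n) : HVars a b n :=
  Sum.inr (finSumFinEquiv (Sum.inr (finProdFinEquiv q)))

/-- The row recogniser `R_a(β)`. [cite: BurgisserClausenShokrollahi1997, Prop. (21.15)] -/
def recA : MvPolynomial (HVars a b n) k :=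
  (∏ pq ∈ fnConflicts a n, (1 - X (yv a b n pq.1) * X (yv a b n pq.2))) *
    ∏ t : Fin a, ∑ i : Fin n, X (yv a b n (t, i))

/-- The column recogniser `R_b(β')`. [cite: BurgisserClausenShokrollahi1997, Prop. (21.15)] -/
def recB : MvPolynomial (HVars a b n) k :=
  (∏ pq ∈ fnConflicts b n, (1 - X (zv a b n pq.1) * X (zv a b n pq.2))) *
    ∏ t : Fin b, ∑ i : Fin n, X (zv a b n (t, i))

variable {a b}

/-- The edge product `Π_{(u,v) ∈ E} Σ_{i,j} β_{u,i} β'_{v,j} X_{ij}`. [cite: DwivediPagoSeppelt2026, eq. (1)] -/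
def edgeProd (E : Multiset (Fin a × Fin b)) : MvPolynomial (HVars a b n) k :=
  (E.map fun e => ∑ v : Fin n, ∑ w : Fin n,
    X (yv a b n (e.1, v)) * X (zv a b n (e.2, w)) * X (Sum.inl (v, w))).prod

/-- The `VNP` witness of `hom_{F,n}` for `F = (Fin a ⊔ Fin b, E)`: `R_a · (R_b · edge product)`.
[cite: DwivediPagoSeppelt2026, eq. (1)] -/
def homWitness (E : Multiset (Fin a × Fin b)) : MvPolynomial (HVars a b n) k :=
  recA a b n k * (recB a b n k * edgeProd n k E)

/-- Packing a pair of Boolean matrices into one Boolean vector of length `a n + b n`. [folklore] -/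
def pack (β : (Fin a × Fin n → Bool) × (Fin b × Fin n → Bool)) : Fin (a * n + b * n) → Bool :=
  fun j => Sum.elim (fun i => β.1 (finProdFinEquiv.symm i)) (fun i => β.2 (finProdFinEquiv.symm i))
    (finSumFinEquiv.symm j)

/-- `pack` at a row-block index returns the row matrix entry. [folklore] -/
@[simp] theorem pack_yv (β : (Fin a × Fin n → Bool) × (Fin b × Fin n → Bool)) (p : Fin a × Fin n) :
    pack n β (finSumFinEquiv (Sum.inl (finProdFinEquiv p))) = β.1 p := by
  simp only [pack, Equiv.symm_apply_apply, Sum.elim_inl]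

/-- `pack` at a column-block index returns the column matrix entry. [folklore] -/
@[simp] theorem pack_zv (β : (Fin a × Fin n → Bool) × (Fin b × Fin n → Bool)) (q : Fin b × Fin n) :
    pack n β (finSumFinEquiv (Sum.inr (finProdFinEquiv q))) = β.2 q := by
  simp only [pack, Equiv.symm_apply_apply, Sum.elim_inr]

/-- `pack` is a bijection. [folklore] -/
def packEquiv : (Fin a × Fin n → Bool) × (Fin b × Fin n → Bool) ≃ (Fin (a * n + b * n) → Bool) where
  toFun := pack n
  invFun e := (fun p => e (finSumFinEquiv (Sum.inl (finProdFinEquiv p))),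
    fun q => e (finSumFinEquiv (Sum.inr (finProdFinEquiv q))))
  left_inv β := Prod.ext (funext fun p => pack_yv n β p) (funext fun q => pack_zv n β q)
  right_inv e := by
    funext j
    rcases hj : finSumFinEquiv.symm j with i | i
    · have : j = finSumFinEquiv (Sum.inl i) := by
        rw [← hj, Equiv.apply_symm_apply]
      rw [this, show (Sum.inl i : Fin (a * n) ⊕ Fin (b * n)) =
        Sum.inl (finProdFinEquiv (finProdFinEquiv.symm i)) by rw [Equiv.apply_symm_apply], pack_yv]
    · have : j = finSumFinEquiv (Sum.inr i) := by
        rw [← hj, Equiv.apply_symm_apply]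
      rw [this, show (Sum.inr i : Fin (a * n) ⊕ Fin (b * n)) =
        Sum.inr (finProdFinEquiv (finProdFinEquiv.symm i)) by rw [Equiv.apply_symm_apply], pack_zv]

/-- Double Boolean sum against the two recognisers = double sum over pairs of functions. [folklore] -/
theorem sum_sum_fnRecogniser_mul {R : Type*} [CommRing R]
    (G : (Fin a × Fin n → Bool) → (Fin b × Fin n → Bool) → R) :
    ∑ βA : Fin a × Fin n → Bool, ∑ βB : Fin b × Fin n → Bool,
      (∏ pq ∈ fnConflicts a n, (1 - (if βA pq.1 then (1 : R) else 0) *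
          (if βA pq.2 then (1 : R) else 0))) *
        (∏ t, ∑ i, (if βA (t, i) then (1 : R) else 0)) *
        ((∏ pq ∈ fnConflicts b n, (1 - (if βB pq.1 then (1 : R) else 0) *
            (if βB pq.2 then (1 : R) else 0))) *
          (∏ t, ∑ i, (if βB (t, i) then (1 : R) else 0)) * G βA βB) =
      ∑ h : Fin a → Fin n, ∑ h' : Fin b → Fin n, G (fnGraph h) (fnGraph h') := by
  simp_rw [← Finset.mul_sum]
  rw [sum_fnRecogniser_mul (fun βA => ∑ βB : Fin b × Fin n → Bool,
    (∏ pq ∈ fnConflicts b n, (1 - (if βB pq.1 then (1 : R) else 0) *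
        (if βB pq.2 then (1 : R) else 0))) *
      (∏ t, ∑ i, (if βB (t, i) then (1 : R) else 0)) * G βA βB)]
  exact Finset.sum_congr rfl fun h _ => sum_fnRecogniser_mul _

/-- **`hom_{F,n}` is the Boolean sum of the witness.** [cite: DwivediPagoSeppelt2026, eq. (1); BurgisserClausenShokrollahi1997, Prop. (21.15)] -/
theorem boolSum_homWitness (E : Multiset (Fin a × Fin b)) :
    boolSum (homWitness n k E) = homPoly E n k := by
  classical
  unfold boolSum homWitness recA recB edgeProd
  simp only [map_mul, map_prod, map_sum, map_sub, map_one, map_multiset_prod, Multiset.map_map,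
    Function.comp_def, aeval_X, Sum.elim_inl, Sum.elim_inr, yv, zv]
  -- re-index the Boolean vectors by pairs of Boolean matrices
  rw [← Equiv.sum_comp (packEquiv n (a := a) (b := b)), Fintype.sum_prod_type]
  simp only [packEquiv, Equiv.coe_fn_mk, pack_yv, pack_zv]
  -- sum out the row block, then the column block
  rw [sum_sum_fnRecogniser_mul]
  -- evaluate the edge product at a pair of graphs
  unfold homPoly
  rw [Fintype.sum_prod_type]
  refine Finset.sum_congr rfl fun h _ => Finset.sum_congr rfl fun h' _ => ?_
  refine congrArg Multiset.prod (Multiset.map_congr rfl fun e _ => ?_)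
  simp only [fnGraph, decide_eq_true_eq]
  rw [Finset.sum_eq_single (h e.1)]
  · rw [Finset.sum_eq_single (h' e.2)]
    · simp
    · intro w _ hw
      rw [if_neg (Ne.symm hw), mul_zero, zero_mul]
    · simp
  · intro v _ hv
    simp [Ne.symm hv]
  · simp

end Witness

end HomPolyVNP

end Summit.ValiantsHypothesis.ValiantsHypothesis.Theorems

end
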